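import Summits.ResolutionOfSingularities.ResolutionOfSingularities.Theorems.PurelyInseparableDim4PureLeafUnitOddReservoirPrep
import HarnessLib
import HarnessLib.Audit.Tags

/-!
# Purely inseparable fourfolds — UNIT LEAVES WITH `a₀ = 1`: the grind transitions of the `Q`-orbit `S²(x₀ + x₀²x₁)`, `S²(x₀ + x₁ + x₀²x₁)` (steps)
# (cell res-dim4-pi; brick (δ) «unit leaves x^a(1+x_j)», UNIFORM family «a₀ = 1, one odd partner, even rest») [OURS · counted 0 · a theorem about OUR coordinate-centre frame v4, not about resolution]

Width seat `res-dim4-p-10` (g5).  THIS FILE (steps): the four GRIND TRANSITIONS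
`step_F_grind2_Q`, `step_F_grind3_Q`, `step_F_grind2_R`, `step_F_grind3_R` — at a `Q`-state `S²(x₀ + x₀²x₁)` or an `R`-state
`S²(x₀ + x₁ + x₀²x₁)` with even dress `S² = x₂^{g₂}(1+x₂)^{e₂}x₃^{g₃}(1+x₃)^{e₃}`, `g_i ≥ 2`, the cleaned transform of the reply `b`
(`b_i = 0`) in the chart `x_i` of the centre `{x_i}` is the `Q`-state (iff `b₀ = 0` at `Q`, `b₀ = 1` at `R`) or the `R`-state of the
dress with `g_i` lowered by `2` and the other dress variable swapped at B's will (`x^{c} ↔ (1+x)^{c}`).  Proof: the transform is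
additive; each product term is chart-and-swapped by p-10 g2's `chartTransform_singleton_prod` / `translate_prod_zmod2`, cleaned by
the term identities of `…UnitOddReservoirPrep`, and reassembled (`(1+x₀)² = 1 + x₀²`, `P + P = 0`).

Riders: `𝔽₂`-rational replies (the game over `ZMod 2`); the PLAIN coordinate game of OUR frame v4 (`StateWins 2`), not MODE 1h
and not CJS's algorithm; nothing here proves F4-C(2,2), `Terminates1h 2 2` or resolution of singularities in dimension ≥ 4 /
characteristic `p`; counted 0; AI kernel work, weaker than expert review. bears_on: LADDER-RESOLUTION:D157-DOOR2 (res-dim4-pi ·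
brick (δ) · unit-leaf row, uniform theorem). Supports stmt-ResolutionOfSingularities-16155 (helper).
-/

set_option linter.dupNamespace false

open MvPolynomial Finset

open scoped BigOperators

noncomputable section

namespace Summit.ResolutionOfSingularities.ResolutionOfSingularities.Theorems.PIDim4

namespace PureLeafNF

open Literature.AlgebraicGeometry.Resolution
open Literature.AlgebraicGeometry.Resolution.Hauser2010
open CentreBlowup PthPowerFactor

/-! ## 4. The grind transitions

`Q·S² := x₀S² + x₀²x₁S²` and `R·S² := x₀S² + x₁S² + x₀²x₁S²` with the even dress `S² = x₂^{g₂}(1+x₂)^{e₂}x₃^{g₃}(1+x₃)^{e₃}`.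
A grinds a dress variable `x_i` with `g_i ≥ 2`; B's reply (`b_i = 0`) swaps the other dress variable at will and translates
`x₀, x₁`: the cleaned transform is again `Q·S′²` (if `b₀ = 0` at a `Q`-state, `b₀ = 1` at an `R`-state) or `R·S′²`, with
`deg S′ = deg S − 1`. -/

/-- **Grind transition at a `Q`-state, chart `x₂`.** [folklore] -/
theorem step_F_grind2_Q (g2 g3 e2 e3 : ℕ) (hg2 : g2 % 2 = 0) (hg3 : g3 % 2 = 0) (he2 : e2 % 2 = 0) (he3 : e3 % 2 = 0) (hg2i : 2 ≤ g2)
    (b : Fin 4 → ZMod 2) (hb : b 2 = 0) (r : Fin 4 →₀ ℕ) (exc : Finset (Fin 4)) :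
    ((step 2 {2} 2 b (⟨((∏ l, X l ^ (![1, 0, g2, g3] : Fin 4 → ℕ) l * (1 + X l) ^ (![0, 0, e2, e3] : Fin 4 → ℕ) l : MvPolynomial (Fin 4) (ZMod 2)) + (∏ l, X l ^ (![2, 1, g2, g3] : Fin 4 → ℕ) l * (1 + X l) ^ (![0, 0, e2, e3] : Fin 4 → ℕ) l : MvPolynomial (Fin 4) (ZMod 2))), r, exc⟩ : State (ZMod 2))).F =
        ((∏ l, X l ^ (![1, 0, (g2 - 2), (if b 3 = 0 then g3 else e3)] : Fin 4 → ℕ) l * (1 + X l) ^ (![0, 0, e2, (if b 3 = 0 then e3 else g3)] : Fin 4 → ℕ) l : MvPolynomial (Fin 4) (ZMod 2)) + (∏ l, X l ^ (![2, 1, (g2 - 2), (if b 3 = 0 then g3 else e3)] : Fin 4 → ℕ) l * (1 + X l) ^ (![0, 0, e2, (if b 3 = 0 then e3 else g3)] : Fin 4 → ℕ) l : MvPolynomial (Fin 4) (ZMod 2))) ∧ b 0 = 0) ∨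
    ((step 2 {2} 2 b (⟨((∏ l, X l ^ (![1, 0, g2, g3] : Fin 4 → ℕ) l * (1 + X l) ^ (![0, 0, e2, e3] : Fin 4 → ℕ) l : MvPolynomial (Fin 4) (ZMod 2)) + (∏ l, X l ^ (![2, 1, g2, g3] : Fin 4 → ℕ) l * (1 + X l) ^ (![0, 0, e2, e3] : Fin 4 → ℕ) l : MvPolynomial (Fin 4) (ZMod 2))), r, exc⟩ : State (ZMod 2))).F =
        ((∏ l, X l ^ (![1, 0, (g2 - 2), (if b 3 = 0 then g3 else e3)] : Fin 4 → ℕ) l * (1 + X l) ^ (![0, 0, e2, (if b 3 = 0 then e3 else g3)] : Fin 4 → ℕ) l : MvPolynomial (Fin 4) (ZMod 2)) + (∏ l, X l ^ (![0, 1, (g2 - 2), (if b 3 = 0 then g3 else e3)] : Fin 4 → ℕ) l * (1 + X l) ^ (![0, 0, e2, (if b 3 = 0 then e3 else g3)] : Fin 4 → ℕ) l : MvPolynomial (Fin 4) (ZMod 2)) + (∏ l, X l ^ (![2, 1, (g2 - 2), (if b 3 = 0 then g3 else e3)] : Fin 4 → ℕ) l * (1 + X l) ^ (![0, 0, e2,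 (if b 3 = 0 then e3 else g3)] : Fin 4 → ℕ) l : MvPolynomial (Fin 4) (ZMod 2))) ∧ b 0 = 1) := by
  have hP : ∀ n : ℕ, n % 2 = 0 → ∀ m : ℕ, m % 2 = 0 → (if b 3 = 0 then n else m) % 2 = 0 := by
    intro n hn m hm; split_ifs <;> assumption
  have hp' : (g2 - 2) % 2 = 0 := by omega
  have hq' : (if b 3 = 0 then g3 else e3) % 2 = 0 := by exact hP _ hg3 _ he3
  have hr' : e2 % 2 = 0 := by omega
  have hs' : (if b 3 = 0 then e3 else g3) % 2 = 0 := by exact hP _ he3 _ hg3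
  change deletePthPowers 2 (PointBlowup.translate b (chartTransform 2 {2} 2 ((∏ l, X l ^ (![1, 0, g2, g3] : Fin 4 → ℕ) l * (1 + X l) ^ (![0, 0, e2, e3] : Fin 4 → ℕ) l : MvPolynomial (Fin 4) (ZMod 2)) + (∏ l, X l ^ (![2, 1, g2, g3] : Fin 4 → ℕ) l * (1 + X l) ^ (![0, 0, e2, e3] : Fin 4 → ℕ) l : MvPolynomial (Fin 4) (ZMod 2))))) = _ ∧ _ ∨
    deletePthPowers 2 (PointBlowup.translate b (chartTransform 2 {2} 2 ((∏ l, X l ^ (![1, 0, g2, g3] : Fin 4 → ℕ) l * (1 + X l) ^ (![0, 0, e2, e3] : Fin 4 → ℕ) l : MvPolynomial (Fin 4) (ZMod 2)) + (∏ l, X l ^ (![2, 1, g2, g3] : Fin 4 → ℕ) l * (1 + X l) ^ (![0, 0, e2, e3] : Fin 4 → ℕ) l : MvPolynomial (Fin 4) (ZMod 2))))) = _ ∧ _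
  simp only [chartTransform_add, MohAlong.translate_add, deletePthPowers_add]
  rw [translate_chartTransform_singleton_prod (![1, 0, g2, g3] : Fin 4 → ℕ) (![0, 0, e2, e3] : Fin 4 → ℕ) (i := 2) (by simpa using hg2i) b, translate_chartTransform_singleton_prod (![2, 1, g2, g3] : Fin 4 → ℕ) (![0, 0, e2, e3] : Fin 4 → ℕ) (i := 2) (by simpa using hg2i) b]
  rcases (by decide : ∀ z : ZMod 2, z = 0 ∨ z = 1) (b 0) with h0 | h0 <;>
    rcases (by decide : ∀ z : ZMod 2, z = 0 ∨ z = 1) (b 1) with h1 | h1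
  · -- case b₀ = 0, b₁ = 0
    left
    refine ⟨?_, h0⟩
    rw [show (∏ l, X l ^ (if b l = 0 then Function.update (![1, 0, g2, g3] : Fin 4 → ℕ) 2 ((![1, 0, g2, g3] : Fin 4 → ℕ) 2 - 2) l else (![0, 0, e2, e3] : Fin 4 → ℕ) l) *
        (1 + X l) ^ (if b l = 0 then (![0, 0, e2, e3] : Fin 4 → ℕ) l else Function.update (![1, 0, g2, g3] : Fin 4 → ℕ) 2 ((![1, 0, g2, g3] : Fin 4 → ℕ) 2 - 2) l) : MvPolynomial (Fin 4) (ZMod 2)) =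
        (∏ l, X l ^ (![1, 0, (g2 - 2), (if b 3 = 0 then g3 else e3)] : Fin 4 → ℕ) l * (1 + X l) ^ (![0, 0, e2, (if b 3 = 0 then e3 else g3)] : Fin 4 → ℕ) l : MvPolynomial (Fin 4) (ZMod 2)) from
      Finset.prod_congr rfl fun l _ => by fin_cases l <;> simp [h0, h1, hb]]
    rw [show (∏ l, X l ^ (if b l = 0 then Function.update (![2, 1, g2, g3] : Fin 4 → ℕ) 2 ((![2, 1, g2, g3] : Fin 4 → ℕ) 2 - 2) l else (![0, 0, e2, e3] : Fin 4 → ℕ) l) *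
        (1 + X l) ^ (if b l = 0 then (![0, 0, e2, e3] : Fin 4 → ℕ) l else Function.update (![2, 1, g2, g3] : Fin 4 → ℕ) 2 ((![2, 1, g2, g3] : Fin 4 → ℕ) 2 - 2) l) : MvPolynomial (Fin 4) (ZMod 2)) =
        (∏ l, X l ^ (![2, 1, (g2 - 2), (if b 3 = 0 then g3 else e3)] : Fin 4 → ℕ) l * (1 + X l) ^ (![0, 0, e2, (if b 3 = 0 then e3 else g3)] : Fin 4 → ℕ) l : MvPolynomial (Fin 4) (ZMod 2)) from
      Finset.prod_congr rfl fun l _ => by fin_cases l <;> simp [h0, h1, hb]]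
    rw [deletePthPowers_prod_of_purelyOdd (![1, 0, (g2 - 2), (if b 3 = 0 then g3 else e3)] : Fin 4 → ℕ) (![0, 0, e2, (if b 3 = 0 then e3 else g3)] : Fin 4 → ℕ) (l := 0) (by simp) (by simp), deletePthPowers_prod_of_purelyOdd (![2, 1, (g2 - 2), (if b 3 = 0 then g3 else e3)] : Fin 4 → ℕ) (![0, 0, e2, (if b 3 = 0 then e3 else g3)] : Fin 4 → ℕ) (l := 1) (by simp) (by simp)]
  · -- case b₀ = 0, b₁ = 1
    left
    refine ⟨?_, h0⟩
    rw [show (∏ l, X l ^ (if b l = 0 then Function.update (![1, 0, g2, g3] : Fin 4 → ℕ) 2 ((![1, 0, g2, g3] : Fin 4 → ℕ) 2 - 2) l else (![0, 0, e2, e3] : Fin 4 → ℕ) l) *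
        (1 + X l) ^ (if b l = 0 then (![0, 0, e2, e3] : Fin 4 → ℕ) l else Function.update (![1, 0, g2, g3] : Fin 4 → ℕ) 2 ((![1, 0, g2, g3] : Fin 4 → ℕ) 2 - 2) l) : MvPolynomial (Fin 4) (ZMod 2)) =
        (∏ l, X l ^ (![1, 0, (g2 - 2), (if b 3 = 0 then g3 else e3)] : Fin 4 → ℕ) l * (1 + X l) ^ (![0, 0, e2, (if b 3 = 0 then e3 else g3)] : Fin 4 → ℕ) l : MvPolynomial (Fin 4) (ZMod 2)) from
      Finset.prod_congr rfl fun l _ => by fin_cases l <;> simp [h0, h1, hb]]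
    rw [show (∏ l, X l ^ (if b l = 0 then Function.update (![2, 1, g2, g3] : Fin 4 → ℕ) 2 ((![2, 1, g2, g3] : Fin 4 → ℕ) 2 - 2) l else (![0, 0, e2, e3] : Fin 4 → ℕ) l) *
        (1 + X l) ^ (if b l = 0 then (![0, 0, e2, e3] : Fin 4 → ℕ) l else Function.update (![2, 1, g2, g3] : Fin 4 → ℕ) 2 ((![2, 1, g2, g3] : Fin 4 → ℕ) 2 - 2) l) : MvPolynomial (Fin 4) (ZMod 2)) =
        (∏ l, X l ^ (![2, 0, (g2 - 2), (if b 3 = 0 then g3 else e3)] : Fin 4 → ℕ) l * (1 + X l) ^ (![0, 1, e2, (if b 3 = 0 then e3 else g3)] : Fin 4 → ℕ) l : MvPolynomial (Fin 4) (ZMod 2)) from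
      Finset.prod_congr rfl fun l _ => by fin_cases l <;> simp [h0, h1, hb]]
    rw [deletePthPowers_prod_of_purelyOdd (![1, 0, (g2 - 2), (if b 3 = 0 then g3 else e3)] : Fin 4 → ℕ) (![0, 0, e2, (if b 3 = 0 then e3 else g3)] : Fin 4 → ℕ) (l := 0) (by simp) (by simp), clean_flip1_sq0 _ _ _ _ hp' hq' hr' hs']
  · -- case b₀ = 1, b₁ = 0
    right
    refine ⟨?_, h0⟩
    rw [show (∏ l, X l ^ (if b l = 0 then Function.update (![1, 0, g2, g3] : Fin 4 → ℕ) 2 ((![1, 0, g2, g3] : Fin 4 → ℕ) 2 - 2) l else (![0, 0, e2, e3] : Fin 4 → ℕ) l) *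
        (1 + X l) ^ (if b l = 0 then (![0, 0, e2, e3] : Fin 4 → ℕ) l else Function.update (![1, 0, g2, g3] : Fin 4 → ℕ) 2 ((![1, 0, g2, g3] : Fin 4 → ℕ) 2 - 2) l) : MvPolynomial (Fin 4) (ZMod 2)) =
        (∏ l, X l ^ (![0, 0, (g2 - 2), (if b 3 = 0 then g3 else e3)] : Fin 4 → ℕ) l * (1 + X l) ^ (![1, 0, e2, (if b 3 = 0 then e3 else g3)] : Fin 4 → ℕ) l : MvPolynomial (Fin 4) (ZMod 2)) from
      Finset.prod_congr rfl fun l _ => by fin_cases l <;> simp [h0, h1, hb]]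
    rw [show (∏ l, X l ^ (if b l = 0 then Function.update (![2, 1, g2, g3] : Fin 4 → ℕ) 2 ((![2, 1, g2, g3] : Fin 4 → ℕ) 2 - 2) l else (![0, 0, e2, e3] : Fin 4 → ℕ) l) *
        (1 + X l) ^ (if b l = 0 then (![0, 0, e2, e3] : Fin 4 → ℕ) l else Function.update (![2, 1, g2, g3] : Fin 4 → ℕ) 2 ((![2, 1, g2, g3] : Fin 4 → ℕ) 2 - 2) l) : MvPolynomial (Fin 4) (ZMod 2)) =
        (∏ l, X l ^ (![0, 1, (g2 - 2), (if b 3 = 0 then g3 else e3)] : Fin 4 → ℕ) l * (1 + X l) ^ (![2, 0, e2, (if b 3 = 0 then e3 else g3)] : Fin 4 → ℕ) l : MvPolynomial (Fin 4) (ZMod 2)) from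
      Finset.prod_congr rfl fun l _ => by fin_cases l <;> simp [h0, h1, hb]]
    rw [clean_flip0 _ _ _ _ hp' hq' hr' hs', deletePthPowers_prod_of_purelyOdd (![0, 1, (g2 - 2), (if b 3 = 0 then g3 else e3)] : Fin 4 → ℕ) (![2, 0, e2, (if b 3 = 0 then e3 else g3)] : Fin 4 → ℕ) (l := 1) (by simp) (by simp)]
    rw [split_dsq0]
    ring
  · -- case b₀ = 1, b₁ = 1
    right
    refine ⟨?_, h0⟩
    rw [show (∏ l, X l ^ (if b l = 0 then Function.update (![1, 0, g2, g3] : Fin 4 → ℕ) 2 ((![1, 0, g2, g3] : Fin 4 → ℕ) 2 - 2) l else (![0, 0, e2, e3] : Fin 4 → ℕ) l) *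
        (1 + X l) ^ (if b l = 0 then (![0, 0, e2, e3] : Fin 4 → ℕ) l else Function.update (![1, 0, g2, g3] : Fin 4 → ℕ) 2 ((![1, 0, g2, g3] : Fin 4 → ℕ) 2 - 2) l) : MvPolynomial (Fin 4) (ZMod 2)) =
        (∏ l, X l ^ (![0, 0, (g2 - 2), (if b 3 = 0 then g3 else e3)] : Fin 4 → ℕ) l * (1 + X l) ^ (![1, 0, e2, (if b 3 = 0 then e3 else g3)] : Fin 4 → ℕ) l : MvPolynomial (Fin 4) (ZMod 2)) from
      Finset.prod_congr rfl fun l _ => by fin_cases l <;> simp [h0, h1, hb]]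
    rw [show (∏ l, X l ^ (if b l = 0 then Function.update (![2, 1, g2, g3] : Fin 4 → ℕ) 2 ((![2, 1, g2, g3] : Fin 4 → ℕ) 2 - 2) l else (![0, 0, e2, e3] : Fin 4 → ℕ) l) *
        (1 + X l) ^ (if b l = 0 then (![0, 0, e2, e3] : Fin 4 → ℕ) l else Function.update (![2, 1, g2, g3] : Fin 4 → ℕ) 2 ((![2, 1, g2, g3] : Fin 4 → ℕ) 2 - 2) l) : MvPolynomial (Fin 4) (ZMod 2)) =
        (∏ l, X l ^ (![0, 0, (g2 - 2), (if b 3 = 0 then g3 else e3)] : Fin 4 → ℕ) l * (1 + X l) ^ (![2, 1, e2, (if b 3 = 0 then e3 else g3)] : Fin 4 → ℕ) l : MvPolynomial (Fin 4) (ZMod 2)) from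
      Finset.prod_congr rfl fun l _ => by fin_cases l <;> simp [h0, h1, hb]]
    rw [clean_flip0 _ _ _ _ hp' hq' hr' hs', clean_flip1_dsq0 _ _ _ _ hp' hq' hr' hs']
    rw [split_dsq0]
    ring

/-- **Grind transition at a `Q`-state, chart `x₃`.** [folklore] -/
theorem step_F_grind3_Q (g2 g3 e2 e3 : ℕ) (hg2 : g2 % 2 = 0) (hg3 : g3 % 2 = 0) (he2 : e2 % 2 = 0) (he3 : e3 % 2 = 0) (hg3i : 2 ≤ g3)
    (b : Fin 4 → ZMod 2) (hb : b 3 = 0) (r : Fin 4 →₀ ℕ) (exc : Finset (Fin 4)) :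
    ((step 2 {3} 3 b (⟨((∏ l, X l ^ (![1, 0, g2, g3] : Fin 4 → ℕ) l * (1 + X l) ^ (![0, 0, e2, e3] : Fin 4 → ℕ) l : MvPolynomial (Fin 4) (ZMod 2)) + (∏ l, X l ^ (![2, 1, g2, g3] : Fin 4 → ℕ) l * (1 + X l) ^ (![0, 0, e2, e3] : Fin 4 → ℕ) l : MvPolynomial (Fin 4) (ZMod 2))), r, exc⟩ : State (ZMod 2))).F =
        ((∏ l, X l ^ (![1, 0, (if b 2 = 0 then g2 else e2), (g3 - 2)] : Fin 4 → ℕ) l * (1 + X l) ^ (![0, 0, (if b 2 = 0 then e2 else g2), e3] : Fin 4 → ℕ) l : MvPolynomial (Fin 4) (ZMod 2)) + (∏ l, X l ^ (![2, 1, (if b 2 = 0 then g2 else e2), (g3 - 2)] : Fin 4 → ℕ) l * (1 + X l) ^ (![0, 0, (if b 2 = 0 then e2 else g2), e3] : Fin 4 → ℕ) l : MvPolynomial (Fin 4) (ZMod 2))) ∧ b 0 = 0) ∨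
    ((step 2 {3} 3 b (⟨((∏ l, X l ^ (![1, 0, g2, g3] : Fin 4 → ℕ) l * (1 + X l) ^ (![0, 0, e2, e3] : Fin 4 → ℕ) l : MvPolynomial (Fin 4) (ZMod 2)) + (∏ l, X l ^ (![2, 1, g2, g3] : Fin 4 → ℕ) l * (1 + X l) ^ (![0, 0, e2, e3] : Fin 4 → ℕ) l : MvPolynomial (Fin 4) (ZMod 2))), r, exc⟩ : State (ZMod 2))).F =
        ((∏ l, X l ^ (![1, 0, (if b 2 = 0 then g2 else e2), (g3 - 2)] : Fin 4 → ℕ) l * (1 + X l) ^ (![0, 0, (if b 2 = 0 then e2 else g2), e3] : Fin 4 → ℕ) l : MvPolynomial (Fin 4) (ZMod 2)) + (∏ l, X l ^ (![0, 1, (if b 2 = 0 then g2 else e2), (g3 - 2)] : Fin 4 → ℕ) l * (1 + X l) ^ (![0, 0, (if b 2 = 0 then e2 else g2), e3] : Fin 4 → ℕ) l : MvPolynomial (Fin 4) (ZMod 2)) + (∏ l, X l ^ (![2, 1, (if b 2 = 0 then g2 else e2), (g3 - 2)] : Fin 4 → ℕ) l * (1 + X l) ^ (![0, 0, (if b 2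 = 0 then e2 else g2), e3] : Fin 4 → ℕ) l : MvPolynomial (Fin 4) (ZMod 2))) ∧ b 0 = 1) := by
  have hP : ∀ n : ℕ, n % 2 = 0 → ∀ m : ℕ, m % 2 = 0 → (if b 2 = 0 then n else m) % 2 = 0 := by
    intro n hn m hm; split_ifs <;> assumption
  have hp' : (if b 2 = 0 then g2 else e2) % 2 = 0 := by exact hP _ hg2 _ he2
  have hq' : (g3 - 2) % 2 = 0 := by omega
  have hr' : (if b 2 = 0 then e2 else g2) % 2 = 0 := by exact hP _ he2 _ hg2
  have hs' : e3 % 2 = 0 := by omega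
  change deletePthPowers 2 (PointBlowup.translate b (chartTransform 2 {3} 3 ((∏ l, X l ^ (![1, 0, g2, g3] : Fin 4 → ℕ) l * (1 + X l) ^ (![0, 0, e2, e3] : Fin 4 → ℕ) l : MvPolynomial (Fin 4) (ZMod 2)) + (∏ l, X l ^ (![2, 1, g2, g3] : Fin 4 → ℕ) l * (1 + X l) ^ (![0, 0, e2, e3] : Fin 4 → ℕ) l : MvPolynomial (Fin 4) (ZMod 2))))) = _ ∧ _ ∨
    deletePthPowers 2 (PointBlowup.translate b (chartTransform 2 {3} 3 ((∏ l, X l ^ (![1, 0, g2, g3] : Fin 4 → ℕ) l * (1 + X l) ^ (![0, 0, e2, e3] : Fin 4 → ℕ) l : MvPolynomial (Fin 4) (ZMod 2)) + (∏ l, X l ^ (![2, 1, g2, g3] : Fin 4 → ℕ) l * (1 + X l) ^ (![0, 0, e2, e3] : Fin 4 → ℕ) l : MvPolynomial (Fin 4) (ZMod 2))))) = _ ∧ _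
  simp only [chartTransform_add, MohAlong.translate_add, deletePthPowers_add]
  rw [translate_chartTransform_singleton_prod (![1, 0, g2, g3] : Fin 4 → ℕ) (![0, 0, e2, e3] : Fin 4 → ℕ) (i := 3) (by simpa using hg3i) b, translate_chartTransform_singleton_prod (![2, 1, g2, g3] : Fin 4 → ℕ) (![0, 0, e2, e3] : Fin 4 → ℕ) (i := 3) (by simpa using hg3i) b]
  rcases (by decide : ∀ z : ZMod 2, z = 0 ∨ z = 1) (b 0) with h0 | h0 <;>
    rcases (by decide : ∀ z : ZMod 2, z = 0 ∨ z = 1) (b 1) with h1 | h1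
  · -- case b₀ = 0, b₁ = 0
    left
    refine ⟨?_, h0⟩
    rw [show (∏ l, X l ^ (if b l = 0 then Function.update (![1, 0, g2, g3] : Fin 4 → ℕ) 3 ((![1, 0, g2, g3] : Fin 4 → ℕ) 3 - 2) l else (![0, 0, e2, e3] : Fin 4 → ℕ) l) *
        (1 + X l) ^ (if b l = 0 then (![0, 0, e2, e3] : Fin 4 → ℕ) l else Function.update (![1, 0, g2, g3] : Fin 4 → ℕ) 3 ((![1, 0, g2, g3] : Fin 4 → ℕ) 3 - 2) l) : MvPolynomial (Fin 4) (ZMod 2)) =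
        (∏ l, X l ^ (![1, 0, (if b 2 = 0 then g2 else e2), (g3 - 2)] : Fin 4 → ℕ) l * (1 + X l) ^ (![0, 0, (if b 2 = 0 then e2 else g2), e3] : Fin 4 → ℕ) l : MvPolynomial (Fin 4) (ZMod 2)) from
      Finset.prod_congr rfl fun l _ => by fin_cases l <;> simp [h0, h1, hb]]
    rw [show (∏ l, X l ^ (if b l = 0 then Function.update (![2, 1, g2, g3] : Fin 4 → ℕ) 3 ((![2, 1, g2, g3] : Fin 4 → ℕ) 3 - 2) l else (![0, 0, e2, e3] : Fin 4 → ℕ) l) *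
        (1 + X l) ^ (if b l = 0 then (![0, 0, e2, e3] : Fin 4 → ℕ) l else Function.update (![2, 1, g2, g3] : Fin 4 → ℕ) 3 ((![2, 1, g2, g3] : Fin 4 → ℕ) 3 - 2) l) : MvPolynomial (Fin 4) (ZMod 2)) =
        (∏ l, X l ^ (![2, 1, (if b 2 = 0 then g2 else e2), (g3 - 2)] : Fin 4 → ℕ) l * (1 + X l) ^ (![0, 0, (if b 2 = 0 then e2 else g2), e3] : Fin 4 → ℕ) l : MvPolynomial (Fin 4) (ZMod 2)) from
      Finset.prod_congr rfl fun l _ => by fin_cases l <;> simp [h0, h1, hb]]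
    rw [deletePthPowers_prod_of_purelyOdd (![1, 0, (if b 2 = 0 then g2 else e2), (g3 - 2)] : Fin 4 → ℕ) (![0, 0, (if b 2 = 0 then e2 else g2), e3] : Fin 4 → ℕ) (l := 0) (by simp) (by simp), deletePthPowers_prod_of_purelyOdd (![2, 1, (if b 2 = 0 then g2 else e2), (g3 - 2)] : Fin 4 → ℕ) (![0, 0, (if b 2 = 0 then e2 else g2), e3] : Fin 4 → ℕ) (l := 1) (by simp) (by simp)]
  · -- case b₀ = 0, b₁ = 1
    left
    refine ⟨?_, h0⟩
    rw [show (∏ l, X l ^ (if b l = 0 then Function.update (![1, 0, g2, g3] : Fin 4 → ℕ) 3 ((![1, 0, g2, g3] : Fin 4 → ℕ) 3 - 2) l else (![0, 0, e2, e3] : Fin 4 → ℕ) l) *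
        (1 + X l) ^ (if b l = 0 then (![0, 0, e2, e3] : Fin 4 → ℕ) l else Function.update (![1, 0, g2, g3] : Fin 4 → ℕ) 3 ((![1, 0, g2, g3] : Fin 4 → ℕ) 3 - 2) l) : MvPolynomial (Fin 4) (ZMod 2)) =
        (∏ l, X l ^ (![1, 0, (if b 2 = 0 then g2 else e2), (g3 - 2)] : Fin 4 → ℕ) l * (1 + X l) ^ (![0, 0, (if b 2 = 0 then e2 else g2), e3] : Fin 4 → ℕ) l : MvPolynomial (Fin 4) (ZMod 2)) from
      Finset.prod_congr rfl fun l _ => by fin_cases l <;> simp [h0, h1, hb]]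
    rw [show (∏ l, X l ^ (if b l = 0 then Function.update (![2, 1, g2, g3] : Fin 4 → ℕ) 3 ((![2, 1, g2, g3] : Fin 4 → ℕ) 3 - 2) l else (![0, 0, e2, e3] : Fin 4 → ℕ) l) *
        (1 + X l) ^ (if b l = 0 then (![0, 0, e2, e3] : Fin 4 → ℕ) l else Function.update (![2, 1, g2, g3] : Fin 4 → ℕ) 3 ((![2, 1, g2, g3] : Fin 4 → ℕ) 3 - 2) l) : MvPolynomial (Fin 4) (ZMod 2)) =
        (∏ l, X l ^ (![2, 0, (if b 2 = 0 then g2 else e2), (g3 - 2)] : Fin 4 → ℕ) l * (1 + X l) ^ (![0, 1, (if b 2 = 0 then e2 else g2), e3] : Fin 4 → ℕ) l : MvPolynomial (Fin 4) (ZMod 2)) from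
      Finset.prod_congr rfl fun l _ => by fin_cases l <;> simp [h0, h1, hb]]
    rw [deletePthPowers_prod_of_purelyOdd (![1, 0, (if b 2 = 0 then g2 else e2), (g3 - 2)] : Fin 4 → ℕ) (![0, 0, (if b 2 = 0 then e2 else g2), e3] : Fin 4 → ℕ) (l := 0) (by simp) (by simp), clean_flip1_sq0 _ _ _ _ hp' hq' hr' hs']
  · -- case b₀ = 1, b₁ = 0
    right
    refine ⟨?_, h0⟩
    rw [show (∏ l, X l ^ (if b l = 0 then Function.update (![1, 0, g2, g3] : Fin 4 → ℕ) 3 ((![1, 0, g2, g3] : Fin 4 → ℕ) 3 - 2) l else (![0, 0, e2, e3] : Fin 4 → ℕ) l) *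
        (1 + X l) ^ (if b l = 0 then (![0, 0, e2, e3] : Fin 4 → ℕ) l else Function.update (![1, 0, g2, g3] : Fin 4 → ℕ) 3 ((![1, 0, g2, g3] : Fin 4 → ℕ) 3 - 2) l) : MvPolynomial (Fin 4) (ZMod 2)) =
        (∏ l, X l ^ (![0, 0, (if b 2 = 0 then g2 else e2), (g3 - 2)] : Fin 4 → ℕ) l * (1 + X l) ^ (![1, 0, (if b 2 = 0 then e2 else g2), e3] : Fin 4 → ℕ) l : MvPolynomial (Fin 4) (ZMod 2)) from
      Finset.prod_congr rfl fun l _ => by fin_cases l <;> simp [h0, h1, hb]]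
    rw [show (∏ l, X l ^ (if b l = 0 then Function.update (![2, 1, g2, g3] : Fin 4 → ℕ) 3 ((![2, 1, g2, g3] : Fin 4 → ℕ) 3 - 2) l else (![0, 0, e2, e3] : Fin 4 → ℕ) l) *
        (1 + X l) ^ (if b l = 0 then (![0, 0, e2, e3] : Fin 4 → ℕ) l else Function.update (![2, 1, g2, g3] : Fin 4 → ℕ) 3 ((![2, 1, g2, g3] : Fin 4 → ℕ) 3 - 2) l) : MvPolynomial (Fin 4) (ZMod 2)) =
        (∏ l, X l ^ (![0, 1, (if b 2 = 0 then g2 else e2), (g3 - 2)] : Fin 4 → ℕ) l * (1 + X l) ^ (![2, 0, (if b 2 = 0 then e2 else g2), e3] : Fin 4 → ℕ) l : MvPolynomial (Fin 4) (ZMod 2)) from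
      Finset.prod_congr rfl fun l _ => by fin_cases l <;> simp [h0, h1, hb]]
    rw [clean_flip0 _ _ _ _ hp' hq' hr' hs', deletePthPowers_prod_of_purelyOdd (![0, 1, (if b 2 = 0 then g2 else e2), (g3 - 2)] : Fin 4 → ℕ) (![2, 0, (if b 2 = 0 then e2 else g2), e3] : Fin 4 → ℕ) (l := 1) (by simp) (by simp)]
    rw [split_dsq0]
    ring
  · -- case b₀ = 1, b₁ = 1
    right
    refine ⟨?_, h0⟩
    rw [show (∏ l, X l ^ (if b l = 0 then Function.update (![1, 0, g2, g3] : Fin 4 → ℕ) 3 ((![1, 0, g2, g3] : Fin 4 → ℕ) 3 - 2) l else (![0, 0, e2, e3] : Fin 4 → ℕ) l) *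
        (1 + X l) ^ (if b l = 0 then (![0, 0, e2, e3] : Fin 4 → ℕ) l else Function.update (![1, 0, g2, g3] : Fin 4 → ℕ) 3 ((![1, 0, g2, g3] : Fin 4 → ℕ) 3 - 2) l) : MvPolynomial (Fin 4) (ZMod 2)) =
        (∏ l, X l ^ (![0, 0, (if b 2 = 0 then g2 else e2), (g3 - 2)] : Fin 4 → ℕ) l * (1 + X l) ^ (![1, 0, (if b 2 = 0 then e2 else g2), e3] : Fin 4 → ℕ) l : MvPolynomial (Fin 4) (ZMod 2)) from
      Finset.prod_congr rfl fun l _ => by fin_cases l <;> simp [h0, h1, hb]]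
    rw [show (∏ l, X l ^ (if b l = 0 then Function.update (![2, 1, g2, g3] : Fin 4 → ℕ) 3 ((![2, 1, g2, g3] : Fin 4 → ℕ) 3 - 2) l else (![0, 0, e2, e3] : Fin 4 → ℕ) l) *
        (1 + X l) ^ (if b l = 0 then (![0, 0, e2, e3] : Fin 4 → ℕ) l else Function.update (![2, 1, g2, g3] : Fin 4 → ℕ) 3 ((![2, 1, g2, g3] : Fin 4 → ℕ) 3 - 2) l) : MvPolynomial (Fin 4) (ZMod 2)) =
        (∏ l, X l ^ (![0, 0, (if b 2 = 0 then g2 else e2), (g3 - 2)] : Fin 4 → ℕ) l * (1 + X l) ^ (![2, 1, (if b 2 = 0 then e2 else g2), e3] : Fin 4 → ℕ) l : MvPolynomial (Fin 4) (ZMod 2)) from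
      Finset.prod_congr rfl fun l _ => by fin_cases l <;> simp [h0, h1, hb]]
    rw [clean_flip0 _ _ _ _ hp' hq' hr' hs', clean_flip1_dsq0 _ _ _ _ hp' hq' hr' hs']
    rw [split_dsq0]
    ring

/-- **Grind transition at a `R`-state, chart `x₂`.** [folklore] -/
theorem step_F_grind2_R (g2 g3 e2 e3 : ℕ) (hg2 : g2 % 2 = 0) (hg3 : g3 % 2 = 0) (he2 : e2 % 2 = 0) (he3 : e3 % 2 = 0) (hg2i : 2 ≤ g2)
    (b : Fin 4 → ZMod 2) (hb : b 2 = 0) (r : Fin 4 →₀ ℕ) (exc : Finset (Fin 4)) :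
    ((step 2 {2} 2 b (⟨((∏ l, X l ^ (![1, 0, g2, g3] : Fin 4 → ℕ) l * (1 + X l) ^ (![0, 0, e2, e3] : Fin 4 → ℕ) l : MvPolynomial (Fin 4) (ZMod 2)) + (∏ l, X l ^ (![0, 1, g2, g3] : Fin 4 → ℕ) l * (1 + X l) ^ (![0, 0, e2, e3] : Fin 4 → ℕ) l : MvPolynomial (Fin 4) (ZMod 2)) + (∏ l, X l ^ (![2, 1, g2, g3] : Fin 4 → ℕ) l * (1 + X l) ^ (![0, 0, e2, e3] : Fin 4 → ℕ) l : MvPolynomial (Fin 4) (ZMod 2))), r, exc⟩ : State (ZMod 2))).F =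
        ((∏ l, X l ^ (![1, 0, (g2 - 2), (if b 3 = 0 then g3 else e3)] : Fin 4 → ℕ) l * (1 + X l) ^ (![0, 0, e2, (if b 3 = 0 then e3 else g3)] : Fin 4 → ℕ) l : MvPolynomial (Fin 4) (ZMod 2)) + (∏ l, X l ^ (![0, 1, (g2 - 2), (if b 3 = 0 then g3 else e3)] : Fin 4 → ℕ) l * (1 + X l) ^ (![0, 0, e2, (if b 3 = 0 then e3 else g3)] : Fin 4 → ℕ) l : MvPolynomial (Fin 4) (ZMod 2)) + (∏ l, X l ^ (![2, 1, (g2 - 2), (if b 3 = 0 then g3 else e3)] : Fin 4 → ℕ) l * (1 + X l) ^ (![0, 0, e2, (if b 3 = 0 then e3 else g3)] : Fin 4 → ℕ) l : MvPolynomial (Fin 4) (ZMod 2))) ∧ b 0 = 0) ∨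
    ((step 2 {2} 2 b (⟨((∏ l, X l ^ (![1, 0, g2, g3] : Fin 4 → ℕ) l * (1 + X l) ^ (![0, 0, e2, e3] : Fin 4 → ℕ) l : MvPolynomial (Fin 4) (ZMod 2)) + (∏ l, X l ^ (![0, 1, g2, g3] : Fin 4 → ℕ) l * (1 + X l) ^ (![0, 0, e2, e3] : Fin 4 → ℕ) l : MvPolynomial (Fin 4) (ZMod 2)) + (∏ l, X l ^ (![2, 1, g2, g3] : Fin 4 → ℕ) l * (1 + X l) ^ (![0, 0, e2, e3] : Fin 4 → ℕ) l : MvPolynomial (Fin 4) (ZMod 2))), r, exc⟩ : State (ZMod 2))).F =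
        ((∏ l, X l ^ (![1, 0, (g2 - 2), (if b 3 = 0 then g3 else e3)] : Fin 4 → ℕ) l * (1 + X l) ^ (![0, 0, e2, (if b 3 = 0 then e3 else g3)] : Fin 4 → ℕ) l : MvPolynomial (Fin 4) (ZMod 2)) + (∏ l, X l ^ (![2, 1, (g2 - 2), (if b 3 = 0 then g3 else e3)] : Fin 4 → ℕ) l * (1 + X l) ^ (![0, 0, e2, (if b 3 = 0 then e3 else g3)] : Fin 4 → ℕ) l : MvPolynomial (Fin 4) (ZMod 2))) ∧ b 0 = 1) := by
  have hP : ∀ n : ℕ, n % 2 = 0 → ∀ m : ℕ, m % 2 = 0 → (if b 3 = 0 then n else m) % 2 = 0 := by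
    intro n hn m hm; split_ifs <;> assumption
  have hp' : (g2 - 2) % 2 = 0 := by omega
  have hq' : (if b 3 = 0 then g3 else e3) % 2 = 0 := by exact hP _ hg3 _ he3
  have hr' : e2 % 2 = 0 := by omega
  have hs' : (if b 3 = 0 then e3 else g3) % 2 = 0 := by exact hP _ he3 _ hg3
  change deletePthPowers 2 (PointBlowup.translate b (chartTransform 2 {2} 2 ((∏ l, X l ^ (![1, 0, g2, g3] : Fin 4 → ℕ) l * (1 + X l) ^ (![0, 0, e2, e3] : Fin 4 → ℕ) l : MvPolynomial (Fin 4) (ZMod 2)) + (∏ l, X l ^ (![0, 1, g2, g3] : Fin 4 → ℕ) l * (1 + X l) ^ (![0, 0, e2, e3] : Fin 4 → ℕ) l : MvPolynomial (Fin 4) (ZMod 2)) + (∏ l, X l ^ (![2, 1, g2, g3] : Fin 4 → ℕ) l * (1 + X l) ^ (![0, 0, e2, e3] : Fin 4 → ℕ) l : MvPolynomial (Fin 4) (ZMod 2))))) = _ ∧ _ ∨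
    deletePthPowers 2 (PointBlowup.translate b (chartTransform 2 {2} 2 ((∏ l, X l ^ (![1, 0, g2, g3] : Fin 4 → ℕ) l * (1 + X l) ^ (![0, 0, e2, e3] : Fin 4 → ℕ) l : MvPolynomial (Fin 4) (ZMod 2)) + (∏ l, X l ^ (![0, 1, g2, g3] : Fin 4 → ℕ) l * (1 + X l) ^ (![0, 0, e2, e3] : Fin 4 → ℕ) l : MvPolynomial (Fin 4) (ZMod 2)) + (∏ l, X l ^ (![2, 1, g2, g3] : Fin 4 → ℕ) l * (1 + X l) ^ (![0, 0, e2, e3] : Fin 4 → ℕ) l : MvPolynomial (Fin 4) (ZMod 2))))) = _ ∧ _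
  simp only [chartTransform_add, MohAlong.translate_add, deletePthPowers_add]
  rw [translate_chartTransform_singleton_prod (![1, 0, g2, g3] : Fin 4 → ℕ) (![0, 0, e2, e3] : Fin 4 → ℕ) (i := 2) (by simpa using hg2i) b, translate_chartTransform_singleton_prod (![0, 1, g2, g3] : Fin 4 → ℕ) (![0, 0, e2, e3] : Fin 4 → ℕ) (i := 2) (by simpa using hg2i) b, translate_chartTransform_singleton_prod (![2, 1, g2, g3] : Fin 4 → ℕ) (![0, 0, e2, e3] : Fin 4 → ℕ) (i := 2) (by simpa using hg2i) b]
  rcases (by decide : ∀ z : ZMod 2, z = 0 ∨ z = 1) (b 0) with h0 | h0 <;>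
    rcases (by decide : ∀ z : ZMod 2, z = 0 ∨ z = 1) (b 1) with h1 | h1
  · -- case b₀ = 0, b₁ = 0
    left
    refine ⟨?_, h0⟩
    rw [show (∏ l, X l ^ (if b l = 0 then Function.update (![1, 0, g2, g3] : Fin 4 → ℕ) 2 ((![1, 0, g2, g3] : Fin 4 → ℕ) 2 - 2) l else (![0, 0, e2, e3] : Fin 4 → ℕ) l) *
        (1 + X l) ^ (if b l = 0 then (![0, 0, e2, e3] : Fin 4 → ℕ) l else Function.update (![1, 0, g2, g3] : Fin 4 → ℕ) 2 ((![1, 0, g2, g3] : Fin 4 → ℕ) 2 - 2) l) : MvPolynomial (Fin 4) (ZMod 2)) =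
        (∏ l, X l ^ (![1, 0, (g2 - 2), (if b 3 = 0 then g3 else e3)] : Fin 4 → ℕ) l * (1 + X l) ^ (![0, 0, e2, (if b 3 = 0 then e3 else g3)] : Fin 4 → ℕ) l : MvPolynomial (Fin 4) (ZMod 2)) from
      Finset.prod_congr rfl fun l _ => by fin_cases l <;> simp [h0, h1, hb]]
    rw [show (∏ l, X l ^ (if b l = 0 then Function.update (![0, 1, g2, g3] : Fin 4 → ℕ) 2 ((![0, 1, g2, g3] : Fin 4 → ℕ) 2 - 2) l else (![0, 0, e2, e3] : Fin 4 → ℕ) l) *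
        (1 + X l) ^ (if b l = 0 then (![0, 0, e2, e3] : Fin 4 → ℕ) l else Function.update (![0, 1, g2, g3] : Fin 4 → ℕ) 2 ((![0, 1, g2, g3] : Fin 4 → ℕ) 2 - 2) l) : MvPolynomial (Fin 4) (ZMod 2)) =
        (∏ l, X l ^ (![0, 1, (g2 - 2), (if b 3 = 0 then g3 else e3)] : Fin 4 → ℕ) l * (1 + X l) ^ (![0, 0, e2, (if b 3 = 0 then e3 else g3)] : Fin 4 → ℕ) l : MvPolynomial (Fin 4) (ZMod 2)) from
      Finset.prod_congr rfl fun l _ => by fin_cases l <;> simp [h0, h1, hb]]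
    rw [show (∏ l, X l ^ (if b l = 0 then Function.update (![2, 1, g2, g3] : Fin 4 → ℕ) 2 ((![2, 1, g2, g3] : Fin 4 → ℕ) 2 - 2) l else (![0, 0, e2, e3] : Fin 4 → ℕ) l) *
        (1 + X l) ^ (if b l = 0 then (![0, 0, e2, e3] : Fin 4 → ℕ) l else Function.update (![2, 1, g2, g3] : Fin 4 → ℕ) 2 ((![2, 1, g2, g3] : Fin 4 → ℕ) 2 - 2) l) : MvPolynomial (Fin 4) (ZMod 2)) =
        (∏ l, X l ^ (![2, 1, (g2 - 2), (if b 3 = 0 then g3 else e3)] : Fin 4 → ℕ) l * (1 + X l) ^ (![0, 0, e2, (if b 3 = 0 then e3 else g3)] : Fin 4 → ℕ) l : MvPolynomial (Fin 4) (ZMod 2)) from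
      Finset.prod_congr rfl fun l _ => by fin_cases l <;> simp [h0, h1, hb]]
    rw [deletePthPowers_prod_of_purelyOdd (![1, 0, (g2 - 2), (if b 3 = 0 then g3 else e3)] : Fin 4 → ℕ) (![0, 0, e2, (if b 3 = 0 then e3 else g3)] : Fin 4 → ℕ) (l := 0) (by simp) (by simp), deletePthPowers_prod_of_purelyOdd (![0, 1, (g2 - 2), (if b 3 = 0 then g3 else e3)] : Fin 4 → ℕ) (![0, 0, e2, (if b 3 = 0 then e3 else g3)] : Fin 4 → ℕ) (l := 1) (by simp) (by simp), deletePthPowers_prod_of_purelyOdd (![2, 1, (g2 - 2), (if b 3 = 0 then g3 else e3)] : Fin 4 → ℕ) (![0, 0, e2, (if b 3 = 0 then e3 else g3)] : Fin 4 → ℕ) (l := 1) (by simp) (by simp)]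
  · -- case b₀ = 0, b₁ = 1
    left
    refine ⟨?_, h0⟩
    rw [show (∏ l, X l ^ (if b l = 0 then Function.update (![1, 0, g2, g3] : Fin 4 → ℕ) 2 ((![1, 0, g2, g3] : Fin 4 → ℕ) 2 - 2) l else (![0, 0, e2, e3] : Fin 4 → ℕ) l) *
        (1 + X l) ^ (if b l = 0 then (![0, 0, e2, e3] : Fin 4 → ℕ) l else Function.update (![1, 0, g2, g3] : Fin 4 → ℕ) 2 ((![1, 0, g2, g3] : Fin 4 → ℕ) 2 - 2) l) : MvPolynomial (Fin 4) (ZMod 2)) =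
        (∏ l, X l ^ (![1, 0, (g2 - 2), (if b 3 = 0 then g3 else e3)] : Fin 4 → ℕ) l * (1 + X l) ^ (![0, 0, e2, (if b 3 = 0 then e3 else g3)] : Fin 4 → ℕ) l : MvPolynomial (Fin 4) (ZMod 2)) from
      Finset.prod_congr rfl fun l _ => by fin_cases l <;> simp [h0, h1, hb]]
    rw [show (∏ l, X l ^ (if b l = 0 then Function.update (![0, 1, g2, g3] : Fin 4 → ℕ) 2 ((![0, 1, g2, g3] : Fin 4 → ℕ) 2 - 2) l else (![0, 0, e2, e3] : Fin 4 → ℕ) l) *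
        (1 + X l) ^ (if b l = 0 then (![0, 0, e2, e3] : Fin 4 → ℕ) l else Function.update (![0, 1, g2, g3] : Fin 4 → ℕ) 2 ((![0, 1, g2, g3] : Fin 4 → ℕ) 2 - 2) l) : MvPolynomial (Fin 4) (ZMod 2)) =
        (∏ l, X l ^ (![0, 0, (g2 - 2), (if b 3 = 0 then g3 else e3)] : Fin 4 → ℕ) l * (1 + X l) ^ (![0, 1, e2, (if b 3 = 0 then e3 else g3)] : Fin 4 → ℕ) l : MvPolynomial (Fin 4) (ZMod 2)) from
      Finset.prod_congr rfl fun l _ => by fin_cases l <;> simp [h0, h1, hb]]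
    rw [show (∏ l, X l ^ (if b l = 0 then Function.update (![2, 1, g2, g3] : Fin 4 → ℕ) 2 ((![2, 1, g2, g3] : Fin 4 → ℕ) 2 - 2) l else (![0, 0, e2, e3] : Fin 4 → ℕ) l) *
        (1 + X l) ^ (if b l = 0 then (![0, 0, e2, e3] : Fin 4 → ℕ) l else Function.update (![2, 1, g2, g3] : Fin 4 → ℕ) 2 ((![2, 1, g2, g3] : Fin 4 → ℕ) 2 - 2) l) : MvPolynomial (Fin 4) (ZMod 2)) =
        (∏ l, X l ^ (![2, 0, (g2 - 2), (if b 3 = 0 then g3 else e3)] : Fin 4 → ℕ) l * (1 + X l) ^ (![0, 1, e2, (if b 3 = 0 then e3 else g3)] : Fin 4 → ℕ) l : MvPolynomial (Fin 4) (ZMod 2)) from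
      Finset.prod_congr rfl fun l _ => by fin_cases l <;> simp [h0, h1, hb]]
    rw [deletePthPowers_prod_of_purelyOdd (![1, 0, (g2 - 2), (if b 3 = 0 then g3 else e3)] : Fin 4 → ℕ) (![0, 0, e2, (if b 3 = 0 then e3 else g3)] : Fin 4 → ℕ) (l := 0) (by simp) (by simp), clean_flip1 _ _ _ _ hp' hq' hr' hs', clean_flip1_sq0 _ _ _ _ hp' hq' hr' hs']
  · -- case b₀ = 1, b₁ = 0
    right
    refine ⟨?_, h0⟩
    rw [show (∏ l, X l ^ (if b l = 0 then Function.update (![1, 0, g2, g3] : Fin 4 → ℕ) 2 ((![1, 0, g2, g3] : Fin 4 → ℕ) 2 - 2) l else (![0, 0, e2, e3] : Fin 4 → ℕ) l) *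
        (1 + X l) ^ (if b l = 0 then (![0, 0, e2, e3] : Fin 4 → ℕ) l else Function.update (![1, 0, g2, g3] : Fin 4 → ℕ) 2 ((![1, 0, g2, g3] : Fin 4 → ℕ) 2 - 2) l) : MvPolynomial (Fin 4) (ZMod 2)) =
        (∏ l, X l ^ (![0, 0, (g2 - 2), (if b 3 = 0 then g3 else e3)] : Fin 4 → ℕ) l * (1 + X l) ^ (![1, 0, e2, (if b 3 = 0 then e3 else g3)] : Fin 4 → ℕ) l : MvPolynomial (Fin 4) (ZMod 2)) from
      Finset.prod_congr rfl fun l _ => by fin_cases l <;> simp [h0, h1, hb]]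
    rw [show (∏ l, X l ^ (if b l = 0 then Function.update (![0, 1, g2, g3] : Fin 4 → ℕ) 2 ((![0, 1, g2, g3] : Fin 4 → ℕ) 2 - 2) l else (![0, 0, e2, e3] : Fin 4 → ℕ) l) *
        (1 + X l) ^ (if b l = 0 then (![0, 0, e2, e3] : Fin 4 → ℕ) l else Function.update (![0, 1, g2, g3] : Fin 4 → ℕ) 2 ((![0, 1, g2, g3] : Fin 4 → ℕ) 2 - 2) l) : MvPolynomial (Fin 4) (ZMod 2)) =
        (∏ l, X l ^ (![0, 1, (g2 - 2), (if b 3 = 0 then g3 else e3)] : Fin 4 → ℕ) l * (1 + X l) ^ (![0, 0, e2, (if b 3 = 0 then e3 else g3)] : Fin 4 → ℕ) l : MvPolynomial (Fin 4) (ZMod 2)) from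
      Finset.prod_congr rfl fun l _ => by fin_cases l <;> simp [h0, h1, hb]]
    rw [show (∏ l, X l ^ (if b l = 0 then Function.update (![2, 1, g2, g3] : Fin 4 → ℕ) 2 ((![2, 1, g2, g3] : Fin 4 → ℕ) 2 - 2) l else (![0, 0, e2, e3] : Fin 4 → ℕ) l) *
        (1 + X l) ^ (if b l = 0 then (![0, 0, e2, e3] : Fin 4 → ℕ) l else Function.update (![2, 1, g2, g3] : Fin 4 → ℕ) 2 ((![2, 1, g2, g3] : Fin 4 → ℕ) 2 - 2) l) : MvPolynomial (Fin 4) (ZMod 2)) =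
        (∏ l, X l ^ (![0, 1, (g2 - 2), (if b 3 = 0 then g3 else e3)] : Fin 4 → ℕ) l * (1 + X l) ^ (![2, 0, e2, (if b 3 = 0 then e3 else g3)] : Fin 4 → ℕ) l : MvPolynomial (Fin 4) (ZMod 2)) from
      Finset.prod_congr rfl fun l _ => by fin_cases l <;> simp [h0, h1, hb]]
    rw [clean_flip0 _ _ _ _ hp' hq' hr' hs', deletePthPowers_prod_of_purelyOdd (![0, 1, (g2 - 2), (if b 3 = 0 then g3 else e3)] : Fin 4 → ℕ) (![0, 0, e2, (if b 3 = 0 then e3 else g3)] : Fin 4 → ℕ) (l := 1) (by simp) (by simp), deletePthPowers_prod_of_purelyOdd (![0, 1, (g2 - 2), (if b 3 = 0 then g3 else e3)] : Fin 4 → ℕ) (![2, 0, e2, (if b 3 = 0 then e3 else g3)] : Fin 4 → ℕ) (l := 1) (by simp) (by simp)]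
    rw [split_dsq0]
    have hc := add_self_eq_zero' (∏ l, X l ^ (![0, 1, (g2 - 2), (if b 3 = 0 then g3 else e3)] : Fin 4 → ℕ) l * (1 + X l) ^ (![0, 0, e2, (if b 3 = 0 then e3 else g3)] : Fin 4 → ℕ) l : MvPolynomial (Fin 4) (ZMod 2))
    linear_combination hc
  · -- case b₀ = 1, b₁ = 1
    right
    refine ⟨?_, h0⟩
    rw [show (∏ l, X l ^ (if b l = 0 then Function.update (![1, 0, g2, g3] : Fin 4 → ℕ) 2 ((![1, 0, g2, g3] : Fin 4 → ℕ) 2 - 2) l else (![0, 0, e2, e3] : Fin 4 → ℕ) l) *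
        (1 + X l) ^ (if b l = 0 then (![0, 0, e2, e3] : Fin 4 → ℕ) l else Function.update (![1, 0, g2, g3] : Fin 4 → ℕ) 2 ((![1, 0, g2, g3] : Fin 4 → ℕ) 2 - 2) l) : MvPolynomial (Fin 4) (ZMod 2)) =
        (∏ l, X l ^ (![0, 0, (g2 - 2), (if b 3 = 0 then g3 else e3)] : Fin 4 → ℕ) l * (1 + X l) ^ (![1, 0, e2, (if b 3 = 0 then e3 else g3)] : Fin 4 → ℕ) l : MvPolynomial (Fin 4) (ZMod 2)) from
      Finset.prod_congr rfl fun l _ => by fin_cases l <;> simp [h0, h1, hb]]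
    rw [show (∏ l, X l ^ (if b l = 0 then Function.update (![0, 1, g2, g3] : Fin 4 → ℕ) 2 ((![0, 1, g2, g3] : Fin 4 → ℕ) 2 - 2) l else (![0, 0, e2, e3] : Fin 4 → ℕ) l) *
        (1 + X l) ^ (if b l = 0 then (![0, 0, e2, e3] : Fin 4 → ℕ) l else Function.update (![0, 1, g2, g3] : Fin 4 → ℕ) 2 ((![0, 1, g2, g3] : Fin 4 → ℕ) 2 - 2) l) : MvPolynomial (Fin 4) (ZMod 2)) =
        (∏ l, X l ^ (![0, 0, (g2 - 2), (if b 3 = 0 then g3 else e3)] : Fin 4 → ℕ) l * (1 + X l) ^ (![0, 1, e2, (if b 3 = 0 then e3 else g3)] : Fin 4 → ℕ) l : MvPolynomial (Fin 4) (ZMod 2)) from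
      Finset.prod_congr rfl fun l _ => by fin_cases l <;> simp [h0, h1, hb]]
    rw [show (∏ l, X l ^ (if b l = 0 then Function.update (![2, 1, g2, g3] : Fin 4 → ℕ) 2 ((![2, 1, g2, g3] : Fin 4 → ℕ) 2 - 2) l else (![0, 0, e2, e3] : Fin 4 → ℕ) l) *
        (1 + X l) ^ (if b l = 0 then (![0, 0, e2, e3] : Fin 4 → ℕ) l else Function.update (![2, 1, g2, g3] : Fin 4 → ℕ) 2 ((![2, 1, g2, g3] : Fin 4 → ℕ) 2 - 2) l) : MvPolynomial (Fin 4) (ZMod 2)) =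
        (∏ l, X l ^ (![0, 0, (g2 - 2), (if b 3 = 0 then g3 else e3)] : Fin 4 → ℕ) l * (1 + X l) ^ (![2, 1, e2, (if b 3 = 0 then e3 else g3)] : Fin 4 → ℕ) l : MvPolynomial (Fin 4) (ZMod 2)) from
      Finset.prod_congr rfl fun l _ => by fin_cases l <;> simp [h0, h1, hb]]
    rw [clean_flip0 _ _ _ _ hp' hq' hr' hs', clean_flip1 _ _ _ _ hp' hq' hr' hs', clean_flip1_dsq0 _ _ _ _ hp' hq' hr' hs']
    rw [split_dsq0]
    have hc := add_self_eq_zero' (∏ l, X l ^ (![0, 1, (g2 - 2), (if b 3 = 0 then g3 else e3)] : Fin 4 → ℕ) l * (1 + X l) ^ (![0, 0, e2, (if b 3 = 0 then e3 else g3)] : Fin 4 → ℕ) l : MvPolynomial (Fin 4) (ZMod 2))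
    linear_combination hc

/-- **Grind transition at a `R`-state, chart `x₃`.** [folklore] -/
theorem step_F_grind3_R (g2 g3 e2 e3 : ℕ) (hg2 : g2 % 2 = 0) (hg3 : g3 % 2 = 0) (he2 : e2 % 2 = 0) (he3 : e3 % 2 = 0) (hg3i : 2 ≤ g3)
    (b : Fin 4 → ZMod 2) (hb : b 3 = 0) (r : Fin 4 →₀ ℕ) (exc : Finset (Fin 4)) :
    ((step 2 {3} 3 b (⟨((∏ l, X l ^ (![1, 0, g2, g3] : Fin 4 → ℕ) l * (1 + X l) ^ (![0, 0, e2, e3] : Fin 4 → ℕ) l : MvPolynomial (Fin 4) (ZMod 2)) + (∏ l, X l ^ (![0, 1, g2, g3] : Fin 4 → ℕ) l * (1 + X l) ^ (![0, 0, e2, e3] : Fin 4 → ℕ) l : MvPolynomial (Fin 4) (ZMod 2)) + (∏ l, X l ^ (![2, 1, g2, g3] : Fin 4 → ℕ) l * (1 + X l) ^ (![0, 0, e2, e3] : Fin 4 → ℕ) l : MvPolynomial (Fin 4) (ZMod 2))), r, exc⟩ : State (ZMod 2))).F =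
        ((∏ l, X l ^ (![1, 0, (if b 2 = 0 then g2 else e2), (g3 - 2)] : Fin 4 → ℕ) l * (1 + X l) ^ (![0, 0, (if b 2 = 0 then e2 else g2), e3] : Fin 4 → ℕ) l : MvPolynomial (Fin 4) (ZMod 2)) + (∏ l, X l ^ (![0, 1, (if b 2 = 0 then g2 else e2), (g3 - 2)] : Fin 4 → ℕ) l * (1 + X l) ^ (![0, 0, (if b 2 = 0 then e2 else g2), e3] : Fin 4 → ℕ) l : MvPolynomial (Fin 4) (ZMod 2)) + (∏ l, X l ^ (![2, 1, (if b 2 = 0 then g2 else e2), (g3 - 2)] : Fin 4 → ℕ) l * (1 + X l) ^ (![0, 0, (if b 2 = 0 then e2 else g2), e3] : Fin 4 → ℕ) l : MvPolynomial (Fin 4) (ZMod 2))) ∧ b 0 = 0) ∨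
    ((step 2 {3} 3 b (⟨((∏ l, X l ^ (![1, 0, g2, g3] : Fin 4 → ℕ) l * (1 + X l) ^ (![0, 0, e2, e3] : Fin 4 → ℕ) l : MvPolynomial (Fin 4) (ZMod 2)) + (∏ l, X l ^ (![0, 1, g2, g3] : Fin 4 → ℕ) l * (1 + X l) ^ (![0, 0, e2, e3] : Fin 4 → ℕ) l : MvPolynomial (Fin 4) (ZMod 2)) + (∏ l, X l ^ (![2, 1, g2, g3] : Fin 4 → ℕ) l * (1 + X l) ^ (![0, 0, e2, e3] : Fin 4 → ℕ) l : MvPolynomial (Fin 4) (ZMod 2))), r, exc⟩ : State (ZMod 2))).F =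
        ((∏ l, X l ^ (![1, 0, (if b 2 = 0 then g2 else e2), (g3 - 2)] : Fin 4 → ℕ) l * (1 + X l) ^ (![0, 0, (if b 2 = 0 then e2 else g2), e3] : Fin 4 → ℕ) l : MvPolynomial (Fin 4) (ZMod 2)) + (∏ l, X l ^ (![2, 1, (if b 2 = 0 then g2 else e2), (g3 - 2)] : Fin 4 → ℕ) l * (1 + X l) ^ (![0, 0, (if b 2 = 0 then e2 else g2), e3] : Fin 4 → ℕ) l : MvPolynomial (Fin 4) (ZMod 2))) ∧ b 0 = 1) := by
  have hP : ∀ n : ℕ, n % 2 = 0 → ∀ m : ℕ, m % 2 = 0 → (if b 2 = 0 then n else m) % 2 = 0 := by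
    intro n hn m hm; split_ifs <;> assumption
  have hp' : (if b 2 = 0 then g2 else e2) % 2 = 0 := by exact hP _ hg2 _ he2
  have hq' : (g3 - 2) % 2 = 0 := by omega
  have hr' : (if b 2 = 0 then e2 else g2) % 2 = 0 := by exact hP _ he2 _ hg2
  have hs' : e3 % 2 = 0 := by omega
  change deletePthPowers 2 (PointBlowup.translate b (chartTransform 2 {3} 3 ((∏ l, X l ^ (![1, 0, g2, g3] : Fin 4 → ℕ) l * (1 + X l) ^ (![0, 0, e2, e3] : Fin 4 → ℕ) l : MvPolynomial (Fin 4) (ZMod 2)) + (∏ l, X l ^ (![0, 1, g2, g3] : Fin 4 → ℕ) l * (1 + X l) ^ (![0, 0, e2, e3] : Fin 4 → ℕ) l : MvPolynomial (Fin 4) (ZMod 2)) + (∏ l, X l ^ (![2, 1, g2, g3] : Fin 4 → ℕ) l * (1 + X l) ^ (![0, 0, e2, e3] : Fin 4 → ℕ) l : MvPolynomial (Fin 4) (ZMod 2))))) = _ ∧ _ ∨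
    deletePthPowers 2 (PointBlowup.translate b (chartTransform 2 {3} 3 ((∏ l, X l ^ (![1, 0, g2, g3] : Fin 4 → ℕ) l * (1 + X l) ^ (![0, 0, e2, e3] : Fin 4 → ℕ) l : MvPolynomial (Fin 4) (ZMod 2)) + (∏ l, X l ^ (![0, 1, g2, g3] : Fin 4 → ℕ) l * (1 + X l) ^ (![0, 0, e2, e3] : Fin 4 → ℕ) l : MvPolynomial (Fin 4) (ZMod 2)) + (∏ l, X l ^ (![2, 1, g2, g3] : Fin 4 → ℕ) l * (1 + X l) ^ (![0, 0, e2, e3] : Fin 4 → ℕ) l : MvPolynomial (Fin 4) (ZMod 2))))) = _ ∧ _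
  simp only [chartTransform_add, MohAlong.translate_add, deletePthPowers_add]
  rw [translate_chartTransform_singleton_prod (![1, 0, g2, g3] : Fin 4 → ℕ) (![0, 0, e2, e3] : Fin 4 → ℕ) (i := 3) (by simpa using hg3i) b, translate_chartTransform_singleton_prod (![0, 1, g2, g3] : Fin 4 → ℕ) (![0, 0, e2, e3] : Fin 4 → ℕ) (i := 3) (by simpa using hg3i) b, translate_chartTransform_singleton_prod (![2, 1, g2, g3] : Fin 4 → ℕ) (![0, 0, e2, e3] : Fin 4 → ℕ) (i := 3) (by simpa using hg3i) b]
  rcases (by decide : ∀ z : ZMod 2, z = 0 ∨ z = 1) (b 0) with h0 | h0 <;>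
    rcases (by decide : ∀ z : ZMod 2, z = 0 ∨ z = 1) (b 1) with h1 | h1
  · -- case b₀ = 0, b₁ = 0
    left
    refine ⟨?_, h0⟩
    rw [show (∏ l, X l ^ (if b l = 0 then Function.update (![1, 0, g2, g3] : Fin 4 → ℕ) 3 ((![1, 0, g2, g3] : Fin 4 → ℕ) 3 - 2) l else (![0, 0, e2, e3] : Fin 4 → ℕ) l) *
        (1 + X l) ^ (if b l = 0 then (![0, 0, e2, e3] : Fin 4 → ℕ) l else Function.update (![1, 0, g2, g3] : Fin 4 → ℕ) 3 ((![1, 0, g2, g3] : Fin 4 → ℕ) 3 - 2) l) : MvPolynomial (Fin 4) (ZMod 2)) =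
        (∏ l, X l ^ (![1, 0, (if b 2 = 0 then g2 else e2), (g3 - 2)] : Fin 4 → ℕ) l * (1 + X l) ^ (![0, 0, (if b 2 = 0 then e2 else g2), e3] : Fin 4 → ℕ) l : MvPolynomial (Fin 4) (ZMod 2)) from
      Finset.prod_congr rfl fun l _ => by fin_cases l <;> simp [h0, h1, hb]]
    rw [show (∏ l, X l ^ (if b l = 0 then Function.update (![0, 1, g2, g3] : Fin 4 → ℕ) 3 ((![0, 1, g2, g3] : Fin 4 → ℕ) 3 - 2) l else (![0, 0, e2, e3] : Fin 4 → ℕ) l) *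
        (1 + X l) ^ (if b l = 0 then (![0, 0, e2, e3] : Fin 4 → ℕ) l else Function.update (![0, 1, g2, g3] : Fin 4 → ℕ) 3 ((![0, 1, g2, g3] : Fin 4 → ℕ) 3 - 2) l) : MvPolynomial (Fin 4) (ZMod 2)) =
        (∏ l, X l ^ (![0, 1, (if b 2 = 0 then g2 else e2), (g3 - 2)] : Fin 4 → ℕ) l * (1 + X l) ^ (![0, 0, (if b 2 = 0 then e2 else g2), e3] : Fin 4 → ℕ) l : MvPolynomial (Fin 4) (ZMod 2)) from
      Finset.prod_congr rfl fun l _ => by fin_cases l <;> simp [h0, h1, hb]]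
    rw [show (∏ l, X l ^ (if b l = 0 then Function.update (![2, 1, g2, g3] : Fin 4 → ℕ) 3 ((![2, 1, g2, g3] : Fin 4 → ℕ) 3 - 2) l else (![0, 0, e2, e3] : Fin 4 → ℕ) l) *
        (1 + X l) ^ (if b l = 0 then (![0, 0, e2, e3] : Fin 4 → ℕ) l else Function.update (![2, 1, g2, g3] : Fin 4 → ℕ) 3 ((![2, 1, g2, g3] : Fin 4 → ℕ) 3 - 2) l) : MvPolynomial (Fin 4) (ZMod 2)) =
        (∏ l, X l ^ (![2, 1, (if b 2 = 0 then g2 else e2), (g3 - 2)] : Fin 4 → ℕ) l * (1 + X l) ^ (![0, 0, (if b 2 = 0 then e2 else g2), e3] : Fin 4 → ℕ) l : MvPolynomial (Fin 4) (ZMod 2)) from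
      Finset.prod_congr rfl fun l _ => by fin_cases l <;> simp [h0, h1, hb]]
    rw [deletePthPowers_prod_of_purelyOdd (![1, 0, (if b 2 = 0 then g2 else e2), (g3 - 2)] : Fin 4 → ℕ) (![0, 0, (if b 2 = 0 then e2 else g2), e3] : Fin 4 → ℕ) (l := 0) (by simp) (by simp), deletePthPowers_prod_of_purelyOdd (![0, 1, (if b 2 = 0 then g2 else e2), (g3 - 2)] : Fin 4 → ℕ) (![0, 0, (if b 2 = 0 then e2 else g2), e3] : Fin 4 → ℕ) (l := 1) (by simp) (by simp), deletePthPowers_prod_of_purelyOdd (![2, 1, (if b 2 = 0 then g2 else e2), (g3 - 2)] : Fin 4 → ℕ) (![0, 0, (if b 2 = 0 then e2 else g2), e3] : Fin 4 → ℕ) (l := 1) (by simp) (by simp)]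
  · -- case b₀ = 0, b₁ = 1
    left
    refine ⟨?_, h0⟩
    rw [show (∏ l, X l ^ (if b l = 0 then Function.update (![1, 0, g2, g3] : Fin 4 → ℕ) 3 ((![1, 0, g2, g3] : Fin 4 → ℕ) 3 - 2) l else (![0, 0, e2, e3] : Fin 4 → ℕ) l) *
        (1 + X l) ^ (if b l = 0 then (![0, 0, e2, e3] : Fin 4 → ℕ) l else Function.update (![1, 0, g2, g3] : Fin 4 → ℕ) 3 ((![1, 0, g2, g3] : Fin 4 → ℕ) 3 - 2) l) : MvPolynomial (Fin 4) (ZMod 2)) =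
        (∏ l, X l ^ (![1, 0, (if b 2 = 0 then g2 else e2), (g3 - 2)] : Fin 4 → ℕ) l * (1 + X l) ^ (![0, 0, (if b 2 = 0 then e2 else g2), e3] : Fin 4 → ℕ) l : MvPolynomial (Fin 4) (ZMod 2)) from
      Finset.prod_congr rfl fun l _ => by fin_cases l <;> simp [h0, h1, hb]]
    rw [show (∏ l, X l ^ (if b l = 0 then Function.update (![0, 1, g2, g3] : Fin 4 → ℕ) 3 ((![0, 1, g2, g3] : Fin 4 → ℕ) 3 - 2) l else (![0, 0, e2, e3] : Fin 4 → ℕ) l) *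
        (1 + X l) ^ (if b l = 0 then (![0, 0, e2, e3] : Fin 4 → ℕ) l else Function.update (![0, 1, g2, g3] : Fin 4 → ℕ) 3 ((![0, 1, g2, g3] : Fin 4 → ℕ) 3 - 2) l) : MvPolynomial (Fin 4) (ZMod 2)) =
        (∏ l, X l ^ (![0, 0, (if b 2 = 0 then g2 else e2), (g3 - 2)] : Fin 4 → ℕ) l * (1 + X l) ^ (![0, 1, (if b 2 = 0 then e2 else g2), e3] : Fin 4 → ℕ) l : MvPolynomial (Fin 4) (ZMod 2)) from
      Finset.prod_congr rfl fun l _ => by fin_cases l <;> simp [h0, h1, hb]]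
    rw [show (∏ l, X l ^ (if b l = 0 then Function.update (![2, 1, g2, g3] : Fin 4 → ℕ) 3 ((![2, 1, g2, g3] : Fin 4 → ℕ) 3 - 2) l else (![0, 0, e2, e3] : Fin 4 → ℕ) l) *
        (1 + X l) ^ (if b l = 0 then (![0, 0, e2, e3] : Fin 4 → ℕ) l else Function.update (![2, 1, g2, g3] : Fin 4 → ℕ) 3 ((![2, 1, g2, g3] : Fin 4 → ℕ) 3 - 2) l) : MvPolynomial (Fin 4) (ZMod 2)) =
        (∏ l, X l ^ (![2, 0, (if b 2 = 0 then g2 else e2), (g3 - 2)] : Fin 4 → ℕ) l * (1 + X l) ^ (![0, 1, (if b 2 = 0 then e2 else g2), e3] : Fin 4 → ℕ) l : MvPolynomial (Fin 4) (ZMod 2)) from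
      Finset.prod_congr rfl fun l _ => by fin_cases l <;> simp [h0, h1, hb]]
    rw [deletePthPowers_prod_of_purelyOdd (![1, 0, (if b 2 = 0 then g2 else e2), (g3 - 2)] : Fin 4 → ℕ) (![0, 0, (if b 2 = 0 then e2 else g2), e3] : Fin 4 → ℕ) (l := 0) (by simp) (by simp), clean_flip1 _ _ _ _ hp' hq' hr' hs', clean_flip1_sq0 _ _ _ _ hp' hq' hr' hs']
  · -- case b₀ = 1, b₁ = 0
    right
    refine ⟨?_, h0⟩
    rw [show (∏ l, X l ^ (if b l = 0 then Function.update (![1, 0, g2, g3] : Fin 4 → ℕ) 3 ((![1, 0, g2, g3] : Fin 4 → ℕ) 3 - 2) l else (![0, 0, e2, e3] : Fin 4 → ℕ) l) *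
        (1 + X l) ^ (if b l = 0 then (![0, 0, e2, e3] : Fin 4 → ℕ) l else Function.update (![1, 0, g2, g3] : Fin 4 → ℕ) 3 ((![1, 0, g2, g3] : Fin 4 → ℕ) 3 - 2) l) : MvPolynomial (Fin 4) (ZMod 2)) =
        (∏ l, X l ^ (![0, 0, (if b 2 = 0 then g2 else e2), (g3 - 2)] : Fin 4 → ℕ) l * (1 + X l) ^ (![1, 0, (if b 2 = 0 then e2 else g2), e3] : Fin 4 → ℕ) l : MvPolynomial (Fin 4) (ZMod 2)) from
      Finset.prod_congr rfl fun l _ => by fin_cases l <;> simp [h0, h1, hb]]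
    rw [show (∏ l, X l ^ (if b l = 0 then Function.update (![0, 1, g2, g3] : Fin 4 → ℕ) 3 ((![0, 1, g2, g3] : Fin 4 → ℕ) 3 - 2) l else (![0, 0, e2, e3] : Fin 4 → ℕ) l) *
        (1 + X l) ^ (if b l = 0 then (![0, 0, e2, e3] : Fin 4 → ℕ) l else Function.update (![0, 1, g2, g3] : Fin 4 → ℕ) 3 ((![0, 1, g2, g3] : Fin 4 → ℕ) 3 - 2) l) : MvPolynomial (Fin 4) (ZMod 2)) =
        (∏ l, X l ^ (![0, 1, (if b 2 = 0 then g2 else e2), (g3 - 2)] : Fin 4 → ℕ) l * (1 + X l) ^ (![0, 0, (if b 2 = 0 then e2 else g2), e3] : Fin 4 → ℕ) l : MvPolynomial (Fin 4) (ZMod 2)) from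
      Finset.prod_congr rfl fun l _ => by fin_cases l <;> simp [h0, h1, hb]]
    rw [show (∏ l, X l ^ (if b l = 0 then Function.update (![2, 1, g2, g3] : Fin 4 → ℕ) 3 ((![2, 1, g2, g3] : Fin 4 → ℕ) 3 - 2) l else (![0, 0, e2, e3] : Fin 4 → ℕ) l) *
        (1 + X l) ^ (if b l = 0 then (![0, 0, e2, e3] : Fin 4 → ℕ) l else Function.update (![2, 1, g2, g3] : Fin 4 → ℕ) 3 ((![2, 1, g2, g3] : Fin 4 → ℕ) 3 - 2) l) : MvPolynomial (Fin 4) (ZMod 2)) =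
        (∏ l, X l ^ (![0, 1, (if b 2 = 0 then g2 else e2), (g3 - 2)] : Fin 4 → ℕ) l * (1 + X l) ^ (![2, 0, (if b 2 = 0 then e2 else g2), e3] : Fin 4 → ℕ) l : MvPolynomial (Fin 4) (ZMod 2)) from
      Finset.prod_congr rfl fun l _ => by fin_cases l <;> simp [h0, h1, hb]]
    rw [clean_flip0 _ _ _ _ hp' hq' hr' hs', deletePthPowers_prod_of_purelyOdd (![0, 1, (if b 2 = 0 then g2 else e2), (g3 - 2)] : Fin 4 → ℕ) (![0, 0, (if b 2 = 0 then e2 else g2), e3] : Fin 4 → ℕ) (l := 1) (by simp) (by simp), deletePthPowers_prod_of_purelyOdd (![0, 1, (if b 2 = 0 then g2 else e2), (g3 - 2)] : Fin 4 → ℕ) (![2, 0, (if b 2 = 0 then e2 else g2), e3] : Fin 4 → ℕ) (l := 1) (by simp) (by simp)]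
    rw [split_dsq0]
    have hc := add_self_eq_zero' (∏ l, X l ^ (![0, 1, (if b 2 = 0 then g2 else e2), (g3 - 2)] : Fin 4 → ℕ) l * (1 + X l) ^ (![0, 0, (if b 2 = 0 then e2 else g2), e3] : Fin 4 → ℕ) l : MvPolynomial (Fin 4) (ZMod 2))
    linear_combination hc
  · -- case b₀ = 1, b₁ = 1
    right
    refine ⟨?_, h0⟩
    rw [show (∏ l, X l ^ (if b l = 0 then Function.update (![1, 0, g2, g3] : Fin 4 → ℕ) 3 ((![1, 0, g2, g3] : Fin 4 → ℕ) 3 - 2) l else (![0, 0, e2, e3] : Fin 4 → ℕ) l) *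
        (1 + X l) ^ (if b l = 0 then (![0, 0, e2, e3] : Fin 4 → ℕ) l else Function.update (![1, 0, g2, g3] : Fin 4 → ℕ) 3 ((![1, 0, g2, g3] : Fin 4 → ℕ) 3 - 2) l) : MvPolynomial (Fin 4) (ZMod 2)) =
        (∏ l, X l ^ (![0, 0, (if b 2 = 0 then g2 else e2), (g3 - 2)] : Fin 4 → ℕ) l * (1 + X l) ^ (![1, 0, (if b 2 = 0 then e2 else g2), e3] : Fin 4 → ℕ) l : MvPolynomial (Fin 4) (ZMod 2)) from
      Finset.prod_congr rfl fun l _ => by fin_cases l <;> simp [h0, h1, hb]]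
    rw [show (∏ l, X l ^ (if b l = 0 then Function.update (![0, 1, g2, g3] : Fin 4 → ℕ) 3 ((![0, 1, g2, g3] : Fin 4 → ℕ) 3 - 2) l else (![0, 0, e2, e3] : Fin 4 → ℕ) l) *
        (1 + X l) ^ (if b l = 0 then (![0, 0, e2, e3] : Fin 4 → ℕ) l else Function.update (![0, 1, g2, g3] : Fin 4 → ℕ) 3 ((![0, 1, g2, g3] : Fin 4 → ℕ) 3 - 2) l) : MvPolynomial (Fin 4) (ZMod 2)) =
        (∏ l, X l ^ (![0, 0, (if b 2 = 0 then g2 else e2), (g3 - 2)] : Fin 4 → ℕ) l * (1 + X l) ^ (![0, 1, (if b 2 = 0 then e2 else g2), e3] : Fin 4 → ℕ) l : MvPolynomial (Fin 4) (ZMod 2)) from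
      Finset.prod_congr rfl fun l _ => by fin_cases l <;> simp [h0, h1, hb]]
    rw [show (∏ l, X l ^ (if b l = 0 then Function.update (![2, 1, g2, g3] : Fin 4 → ℕ) 3 ((![2, 1, g2, g3] : Fin 4 → ℕ) 3 - 2) l else (![0, 0, e2, e3] : Fin 4 → ℕ) l) *
        (1 + X l) ^ (if b l = 0 then (![0, 0, e2, e3] : Fin 4 → ℕ) l else Function.update (![2, 1, g2, g3] : Fin 4 → ℕ) 3 ((![2, 1, g2, g3] : Fin 4 → ℕ) 3 - 2) l) : MvPolynomial (Fin 4) (ZMod 2)) =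
        (∏ l, X l ^ (![0, 0, (if b 2 = 0 then g2 else e2), (g3 - 2)] : Fin 4 → ℕ) l * (1 + X l) ^ (![2, 1, (if b 2 = 0 then e2 else g2), e3] : Fin 4 → ℕ) l : MvPolynomial (Fin 4) (ZMod 2)) from
      Finset.prod_congr rfl fun l _ => by fin_cases l <;> simp [h0, h1, hb]]
    rw [clean_flip0 _ _ _ _ hp' hq' hr' hs', clean_flip1 _ _ _ _ hp' hq' hr' hs', clean_flip1_dsq0 _ _ _ _ hp' hq' hr' hs']
    rw [split_dsq0]
    have hc := add_self_eq_zero' (∏ l, X l ^ (![0, 1, (if b 2 = 0 then g2 else e2), (g3 - 2)] : Fin 4 → ℕ) l * (1 + X l) ^ (![0, 0, (if b 2 = 0 then e2 else g2), e3] : Fin 4 → ℕ) l : MvPolynomial (Fin 4) (ZMod 2))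
    linear_combination hc

end PureLeafNF

end Summit.ResolutionOfSingularities.ResolutionOfSingularities.Theorems.PIDim4

end
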